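import Literature.NumberTheory.Rogawski1990.KottwitzSignDiagonalFrame
import Literature.NumberTheory.Automorphic.Liu2021.LemD1BinaryIsotropyOfPlace
import Literature.NumberTheory.Automorphic.UnitaryGroupNonsplitPlace
import Literature.NumberTheory.Automorphic.QuadraticLocalBaseChange
import HarnessLib

/-!
# Kottwitz signs, VI: the place-by-place READINGS of the signs of a rational split-singular element in its diagonal frame
# (Rogawski 1990, §3.8 Prop. 3.8.1 p. 30; §4.1 (4.1.2) pp. 39–40; §8.2 p. 117; Landherr 1936)

Topic `NumberTheory/Rogawski1990`; namespace `Literature.NumberTheory.Rogawski1990`.  THEOREMS ONLY (no definition, no named fact, no instance,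
no notation, no `sorry`).  Cell `pub/hodgecm-mathlib`, ENGINE T1 (crux H413 = `stmt-HodgeConjecture-24833`), row O7 «singular semisimple classes»,
«KOTTWITZ SIGNS» (F0P3a-plan RULING #116 (W19-1), O7 OWNER WORD #26 (1)(a)(c)); sequel of ★ `KottwitzSignDiagonalFrame`.  HC_CM is proved only modulo
the printed citations until rung 0 closes; this file discharges none of them.

## What is proved

For `H ∈ M₃(L)` hermitian non-degenerate over the CM field `L` (`σ` = complex conjugation) and a RATIONAL split-singular non-central
`γ₀ ∈ U(H)(L⁺)` (`(γ₀ − α)(γ₀ − β) = 0`, `α ≠ β`, `γ₀ ∉ {α·1, β·1}`):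

(the diagonal frame `γ₀ P = P (a·1₂ ⊕ᶠ b·1₁)`, `ᵗ(σP) H P = diag(d₀, d₁, d₂)`, `σ dᵢ = dᵢ ≠ 0` is ★ `exists_diagonal_frame`):
* §2 at a FINITE place `v` of `L⁺`: `kottwitzSignLocal … v ⟦(γ₀)_v⟧ = kottwitzSign (c ⊗ 1) (diag d ⊗ 1) (diag(a,a,b) ⊗ 1)` (★ `kottwitzSign_eq_of_frame`
  through `P ⊗ 1`), and the READING **`kottwitzSignLocal_toAdelic_eq_neg_one_iff_not_isIsotropic`**: `e_v((γ₀)_v) = −1 ↔` the binary hermitian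
  plane `(L ⊗ L⁺_v)²` with Gram matrix `diag(d₀, d₁) ⊗ 1` — ★ `LemD1OfPlace.standingData L v c 2 (diag(d₀,d₁))` — is NOT isotropic
  (non-split `v`: `L ⊗ L⁺_v` is a field, ★ `LocalRing.isField_of_smul_eq`, and ★ `kottwitzSign_diagonal_eq_neg_one_iff`; split `v`: both
  sides fail — `e_v = 1` by ★ `kottwitzSignLocal_eq_one_of_smul_ne` and the plane is isotropic on the vector `(1_w, 0)`).
* §3 at a COMPLEX place `W` of `L`: `kottwitzSignAt … W (γ₀ ⊗ 1) = kottwitzSign conj (diag σ_W(d)) (diag(σ_W a, σ_W a, σ_W b))` and the READING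
  **`kottwitzSignAt_cmRationalToArch_eq_neg_one_iff`**: `e_W(γ₀ ⊗ 1) = −1 ↔ 0 < Re σ_W(d₀ d₁)` (the eigenplane is DEFINITE at `W`).

Sequel `KottwitzSignProductFormula`: W19-4 `kottwitzSignAdelic (toAdelic γ₀) = 1` (Hilbert reciprocity, ★ `LemD1OfPlace.even_ncard_not_isIsotropic_add_ncard_pos`).

## References
* [Rogawski1990] J. D. Rogawski, *Automorphic Representations of Unitary Groups in Three Variables*, Ann. of Math. Stud. 123 (1990), §3.8 Prop. 3.8.1
  p. 30; §4.1 (4.1.2) pp. 39–40; §8.2 p. 117.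
* [Kottwitz1983] R. E. Kottwitz, *Sign changes in harmonic analysis on reductive groups*, Trans. AMS 278 (1983), 289–297.
* [Landherr1936HermitianForms] W. Landherr, *Äquivalenz Hermitescher Formen über einem beliebigen algebraischen Zahlkörper*, Abh. Math. Sem. Hamburg 11
  (1936) 245–248.
-/

set_option autoImplicit false

noncomputable section

open NumberField NumberField.InfinitePlace IsDedekindDomain Matrix
open scoped MatrixGroups ComplexConjugate

namespace Literature.NumberTheory.Rogawski1990

open Literature.NumberTheory.Automorphic
open Literature.AlgebraicGeometry.ShimuraVarieties (unitaryGroup hermForm)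
open Literature.NumberTheory.Automorphic.UnitaryGroup (finSum)

/-! ## §2 The finite places -/

section Finite

variable (L : Type) [Field L] [NumberField L] [IsCMField L] {H : Matrix (Fin 3) (Fin 3) L}

/-- `cmConjRingHom` is an involution. [folklore] -/
private theorem cmConjRingHom_cmConjRingHom' (x : L) : cmConjRingHom L (cmConjRingHom L x) = x := by
  rw [cmConjRingHom_apply, cmConjRingHom_apply, IsCMField.complexConj_apply_apply]

/-- The matrix of `(γ ⊗ 1)_v` is the entrywise image of `γ` (★ `adeleToLocal_comp_algebraMap`; cf. ★ `coe_toLocal_toAdelic_eq_map`).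
[folklore] -/
private theorem coe_toLocal_toAdelic_eq_map' (v : HeightOneSpectrum (𝓞 ↥(maximalRealSubfield L))) (γ : (UnitaryGroup.cmDatum L 3 H).Rational) :
    ((((UnitaryGroup.cmDatum L 3 H).toLocal v ((UnitaryGroup.cmDatum L 3 H).toAdelic γ)).val : GL (Fin 3) (UnitaryGroup.LocalRing L v)).val :
        Matrix (Fin 3) (Fin 3) (UnitaryGroup.LocalRing L v)) =
      (((γ : unitaryGroup (cmConjRingHom L) H).val : GL (Fin 3) L).val : Matrix (Fin 3) (Fin 3) L).map (algebraMap L (UnitaryGroup.LocalRing L v)) := by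
  have hc : ((UnitaryGroup.adeleToLocal L v : AdeleRing (𝓞 L) L → UnitaryGroup.LocalRing L v) ∘
      (algebraMap L (AdeleRing (𝓞 L) L) : L → AdeleRing (𝓞 L) L)) = (algebraMap L (UnitaryGroup.LocalRing L v) : L → UnitaryGroup.LocalRing L v) := by
    funext x
    exact DFunLike.congr_fun (UnitaryGroup.adeleToLocal_comp_algebraMap (E := L) v) x
  change ((((γ : unitaryGroup (cmConjRingHom L) H).val : GL (Fin 3) L).val : Matrix (Fin 3) (Fin 3) L).map
      (algebraMap L (AdeleRing (𝓞 L) L))).map (UnitaryGroup.adeleToLocal L v) = _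
  rw [Matrix.map_map, hc]

variable {L}

/-- **The local sign of `(γ₀)_v` in a diagonal frame is the sign of the diagonal model over `L ⊗ L⁺_v`.**
[cite: Rogawski1990, §3.8 Prop. 3.8.1 p. 30; §4.1 (4.1.2) p. 39] -/
theorem kottwitzSignLocal_toAdelic_eq_diagonal (v : HeightOneSpectrum (𝓞 ↥(maximalRealSubfield L))) (γ₀ : (UnitaryGroup.cmDatum L 3 H).Rational)
    {a b : L} {P : GL (Fin 3) L} {d : Fin 3 → L}
    (hP : (((P : Matrix (Fin 3) (Fin 3) L)).map (cmConjRingHom L))ᵀ * H * (P : Matrix (Fin 3) (Fin 3) L) = Matrix.diagonal d)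
    (hγP : (((γ₀ : unitaryGroup (cmConjRingHom L) H).val : GL (Fin 3) L).val : Matrix (Fin 3) (Fin 3) L) * (P : Matrix (Fin 3) (Fin 3) L) =
      (P : Matrix (Fin 3) (Fin 3) L) * finSum 2 1 (a • (1 : Matrix (Fin 2) (Fin 2) L)) (b • (1 : Matrix (Fin 1) (Fin 1) L))) :
    kottwitzSignLocal L 3 H v (ConjClasses.mk ((UnitaryGroup.cmDatum L 3 H).toLocal v ((UnitaryGroup.cmDatum L 3 H).toAdelic γ₀))) =
      kottwitzSign (UnitaryGroup.conjLocal L (IsCMField.complexConj L) v)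
        (Matrix.diagonal (fun i => algebraMap L (UnitaryGroup.LocalRing L v) (d i)))
        (Matrix.diagonal ![algebraMap L (UnitaryGroup.LocalRing L v) a, algebraMap L (UnitaryGroup.LocalRing L v) a,
          algebraMap L (UnitaryGroup.LocalRing L v) b]) := by
  set ι := algebraMap L (UnitaryGroup.LocalRing L v) with hι
  set σv := UnitaryGroup.conjLocal L (IsCMField.complexConj L) v with hσv
  rw [kottwitzSignLocal_mk, coe_toLocal_toAdelic_eq_map', Liu2021.LemD1OfPlace.localGram_eq]
  -- the mapped frame
  set Pv : GL (Fin 3) (UnitaryGroup.LocalRing L v) := Matrix.GeneralLinearGroup.map ι P with hPv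
  have hPvval : (Pv.val : Matrix (Fin 3) (Fin 3) (UnitaryGroup.LocalRing L v)) = (P : Matrix (Fin 3) (Fin 3) L).map ι := rfl
  have hσι : ∀ x : L, σv (ι x) = ι (cmConjRingHom L x) := fun x => by
    rw [hσv, hι, cmConjRingHom_apply, UnitaryGroup.conjLocal_algebraMap]
  have hframe_v : ((((γ₀ : unitaryGroup (cmConjRingHom L) H).val : GL (Fin 3) L).val : Matrix (Fin 3) (Fin 3) L).map ι) *
      (Pv.val : Matrix (Fin 3) (Fin 3) (UnitaryGroup.LocalRing L v)) =
      (Pv.val : Matrix (Fin 3) (Fin 3) (UnitaryGroup.LocalRing L v)) *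
        finSum 2 1 (ι a • (1 : Matrix (Fin 2) (Fin 2) (UnitaryGroup.LocalRing L v))) (ι b • (1 : Matrix (Fin 1) (Fin 1) (UnitaryGroup.LocalRing L v))) := by
    rw [hPvval, ← Matrix.map_mul, hγP, Matrix.map_mul, finSum_smul_one_eq_diagonal, finSum_smul_one_eq_diagonal,
      Matrix.diagonal_map (map_zero ι)]
    congr 2
    funext i; fin_cases i <;> rfl
  have hcongr_v : ((Pv.val : Matrix (Fin 3) (Fin 3) (UnitaryGroup.LocalRing L v)).map σv)ᵀ * H.map ι *
      (Pv.val : Matrix (Fin 3) (Fin 3) (UnitaryGroup.LocalRing L v)) = Matrix.diagonal (fun i => ι (d i)) := by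
    have hmapσ : ((P : Matrix (Fin 3) (Fin 3) L).map ι).map σv = (((P : Matrix (Fin 3) (Fin 3) L)).map (cmConjRingHom L)).map ι := by
      rw [Matrix.map_map, Matrix.map_map]
      exact congrArg _ (funext fun x => hσι x)
    rw [hPvval, hmapσ, ← Matrix.transpose_map, ← Matrix.map_mul, ← Matrix.map_mul, hP, Matrix.diagonal_map (map_zero ι)]
  rw [kottwitzSign_eq_of_frame σv (H.map ι) Pv hframe_v (fun i => ι (d i)) hcongr_v]

/-- At a SPLIT place (`c • w ≠ w`) `L ⊗ L⁺_v` has an element `ε ≠ 0` with `(c⊗1)(ε)·ε = 0 = (c⊗1)(1−ε)·(1−ε)` — the indicator `1_w`.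
[cite: CasselsFrohlichANT1967, Ch. VII Prop. 1.2 (ii)] -/
theorem exists_conj_mul_self_eq_zero_of_smul_ne (v : HeightOneSpectrum (𝓞 ↥(maximalRealSubfield L))) (w : UnitaryGroup.PlacesOver L v)
    (hw : IsCMField.complexConj L • w.1 ≠ w.1) :
    ∃ ε : UnitaryGroup.LocalRing L v, ε ≠ 0 ∧ UnitaryGroup.conjLocal L (IsCMField.complexConj L) v ε * ε = 0 ∧
      UnitaryGroup.conjLocal L (IsCMField.complexConj L) v (1 - ε) * (1 - ε) = 0 := by
  classical
  set cc := IsCMField.complexConj L with hccdef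
  set ε : UnitaryGroup.LocalRing L v := fun w' => if w' = w then 1 else 0 with hε
  have hgal : UnitaryGroup.PlacesOver.galInv cc w ≠ w := UnitaryGroup.PlacesOver.galInv_ne cc w hw
  have hconj : ∀ (x : UnitaryGroup.LocalRing L v) (w' : UnitaryGroup.PlacesOver L v),
      UnitaryGroup.conjLocal L cc v x w' = galAdicCompletionMap cc (smul_inv_smul cc w'.1) (x (UnitaryGroup.PlacesOver.galInv cc w')) :=
    fun x w' => rfl
  have hε1 : ∀ w', ε w' = if w' = w then 1 else 0 := fun _ => rfl
  refine ⟨ε, ?_, ?_, ?_⟩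
  · intro h0
    have h1 := congrFun h0 w
    rw [hε1, if_pos rfl, Pi.zero_apply] at h1
    exact one_ne_zero h1
  · funext w'
    rw [Pi.mul_apply, Pi.zero_apply, hconj, hε1, hε1]
    by_cases hw' : w' = w
    · subst hw'
      rw [if_neg hgal, map_zero, zero_mul]
    · rw [if_neg hw', mul_zero]
  · funext w'
    rw [Pi.mul_apply, Pi.zero_apply, hconj, Pi.sub_apply, Pi.sub_apply, Pi.one_apply, Pi.one_apply, hε1, hε1]
    by_cases hw' : w' = w
    · subst hw'
      rw [if_pos (rfl : w' = w'), sub_self, mul_zero]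
    · have hw'' : w' = UnitaryGroup.PlacesOver.galInv cc w :=
        (UnitaryGroup.PlacesOver.eq_or_eq_galInv cc (IsCMField.complexConj_ne_one L) w w').resolve_left hw'
      have hback : UnitaryGroup.PlacesOver.galInv cc w' = w := by
        rw [hw'']; exact UnitaryGroup.PlacesOver.galInv_galInv cc (IsCMField.complexConj_ne_one L) w
      rw [if_pos hback, sub_self, map_zero, zero_mul]

/-- The binary form of the standing data of `diag(d₀, d₁)` at `v`, in coordinates. [cite: Liu2021, App. D Lemma D.1 (4)] -/
theorem isIsotropic_standingData_diagonal_iff (v : HeightOneSpectrum (𝓞 ↥(maximalRealSubfield L))) (dJ : Fin 2 → L)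
    {δ : L} (hcδ : IsCMField.complexConj L δ = -δ) (hδ : δ ≠ 0)
    (hJh : ((Matrix.diagonal dJ).map (IsCMField.complexConj L))ᵀ = Matrix.diagonal dJ) (hJdet : (Matrix.diagonal dJ).det ≠ 0) :
    Liu2021.LemD1.IsIsotropic (Liu2021.LemD1OfPlace.standingData L v (IsCMField.complexConj L) 2 (Matrix.diagonal dJ) hcδ hδ le_rfl hJh hJdet) ↔
      ∃ u : Fin 2 → UnitaryGroup.LocalRing L v, u ≠ 0 ∧
        algebraMap L (UnitaryGroup.LocalRing L v) (dJ 0) * (UnitaryGroup.conjLocal L (IsCMField.complexConj L) v (u 0) * u 0) +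
          algebraMap L (UnitaryGroup.LocalRing L v) (dJ 1) * (UnitaryGroup.conjLocal L (IsCMField.complexConj L) v (u 1) * u 1) = 0 := by
  have hform : ∀ u : Fin 2 → UnitaryGroup.LocalRing L v,
      (Liu2021.LemD1OfPlace.standingData L v (IsCMField.complexConj L) 2 (Matrix.diagonal dJ) hcδ hδ le_rfl hJh hJdet).form u u =
        algebraMap L (UnitaryGroup.LocalRing L v) (dJ 0) * (UnitaryGroup.conjLocal L (IsCMField.complexConj L) v (u 0) * u 0) +
          algebraMap L (UnitaryGroup.LocalRing L v) (dJ 1) * (UnitaryGroup.conjLocal L (IsCMField.complexConj L) v (u 1) * u 1) := by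
    intro u
    have hgram : (Liu2021.LemD1OfPlace.standingData L v (IsCMField.complexConj L) 2 (Matrix.diagonal dJ) hcδ hδ le_rfl hJh hJdet).gram =
        Matrix.diagonal (fun i => algebraMap L (UnitaryGroup.LocalRing L v) (dJ i)) := by
      rw [Liu2021.LemD1OfPlace.standingData_gram, Liu2021.LemD1OfPlace.localGram_eq, Matrix.diagonal_map (map_zero _)]
    have hσ : ⇑(Liu2021.LemD1OfPlace.standingData L v (IsCMField.complexConj L) 2 (Matrix.diagonal dJ) hcδ hδ le_rfl hJh hJdet).σ =
        ⇑(UnitaryGroup.conjLocal L (IsCMField.complexConj L) v) := by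
      funext x
      exact Liu2021.LemD1OfPlace.standingData_conj_apply L v (IsCMField.complexConj L) 2 (Matrix.diagonal dJ) hcδ hδ le_rfl hJh hJdet x
    rw [RepresentationTheory.Liu2021.OscillatorStandingData.form, hgram]
    simp only [hermForm, hσ, Matrix.mulVec_diagonal, dotProduct, Fin.sum_univ_two, Function.comp_apply]
    ring
  unfold Liu2021.LemD1.IsIsotropic
  simp only [hform]

/-- **THE FINITE READING: `e_v((γ₀)_v) = −1 ↔` the eigenplane `(diag(d₀,d₁) ⊗ 1)` is ANISOTROPIC at `v`** (the standing data ★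
`LemD1OfPlace.standingData L v c 2 diag(d₀,d₁)` is not isotropic), at EVERY finite place `v` of `L⁺`: at a non-split place `L ⊗ L⁺_v` is
a field and the diagonal model is read by ★ `kottwitzSign_diagonal_eq_neg_one_iff`; at a split place `e_v = 1` (★
`kottwitzSignLocal_eq_one_of_smul_ne`) while `(1_w, 0)` is an isotropic vector of the plane.
[cite: Rogawski1990, §4.1 (4.1.2) p. 39; §3.8 Prop. 3.8.1 (d) p. 30] [cite: Landherr1936HermitianForms] -/
theorem kottwitzSignLocal_toAdelic_eq_neg_one_iff_not_isIsotropic (v : HeightOneSpectrum (𝓞 ↥(maximalRealSubfield L)))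
    (γ₀ : (UnitaryGroup.cmDatum L 3 H).Rational) {a b : L} (hab : IsUnit (a - b)) {P : GL (Fin 3) L} {d : Fin 3 → L}
    (hd0 : ∀ i, d i ≠ 0)
    (hP : (((P : Matrix (Fin 3) (Fin 3) L)).map (cmConjRingHom L))ᵀ * H * (P : Matrix (Fin 3) (Fin 3) L) = Matrix.diagonal d)
    (hγP : (((γ₀ : unitaryGroup (cmConjRingHom L) H).val : GL (Fin 3) L).val : Matrix (Fin 3) (Fin 3) L) * (P : Matrix (Fin 3) (Fin 3) L) =
      (P : Matrix (Fin 3) (Fin 3) L) * finSum 2 1 (a • (1 : Matrix (Fin 2) (Fin 2) L)) (b • (1 : Matrix (Fin 1) (Fin 1) L)))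
    {δ : L} (hcδ : IsCMField.complexConj L δ = -δ) (hδ : δ ≠ 0)
    (hJh : ((Matrix.diagonal ![d 0, d 1]).map (IsCMField.complexConj L))ᵀ = Matrix.diagonal ![d 0, d 1])
    (hJdet : (Matrix.diagonal ![d 0, d 1]).det ≠ 0) :
    kottwitzSignLocal L 3 H v (ConjClasses.mk ((UnitaryGroup.cmDatum L 3 H).toLocal v ((UnitaryGroup.cmDatum L 3 H).toAdelic γ₀))) = -1 ↔
      ¬ Liu2021.LemD1.IsIsotropic
        (Liu2021.LemD1OfPlace.standingData L v (IsCMField.complexConj L) 2 (Matrix.diagonal ![d 0, d 1]) hcδ hδ le_rfl hJh hJdet) := by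
  classical
  set ι := algebraMap L (UnitaryGroup.LocalRing L v) with hι
  set σv := UnitaryGroup.conjLocal L (IsCMField.complexConj L) v with hσv
  obtain ⟨w⟩ : Nonempty (UnitaryGroup.PlacesOver L v) := inferInstance
  rw [isIsotropic_standingData_diagonal_iff]
  simp only [Matrix.cons_val_zero, Matrix.cons_val_one]
  by_cases hw : IsCMField.complexConj L • w.1 = w.1
  · -- NON-SPLIT: `L ⊗ L⁺_v` is a field
    have hF := UnitaryGroup.LocalRing.isField_of_smul_eq (IsCMField.complexConj L) (IsCMField.complexConj_ne_one L) w hw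
    letI : Field (UnitaryGroup.LocalRing L v) := hF.toField
    have hιinj : Function.Injective ι := ι.injective
    have hσinj : Function.Injective σv := σv.injective
    have habv : IsUnit (ι a - ι b) := by rw [← map_sub]; exact hab.map ι
    rw [kottwitzSignLocal_toAdelic_eq_diagonal v γ₀ hP hγP,
      kottwitzSign_diagonal_eq_neg_one_iff σv hσinj habv (fun i => ι (d i)) ((map_ne_zero_iff ι hιinj).2 (hd0 2))]
    constructor
    · rintro h ⟨u, hu0, hu⟩
      exact hu0 (h u hu)
    · intro h u hu
      by_contra hu0
      exact h ⟨u, hu0, hu⟩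
  · -- SPLIT: both sides fail
    have h1 : kottwitzSignLocal L 3 H v (ConjClasses.mk ((UnitaryGroup.cmDatum L 3 H).toLocal v ((UnitaryGroup.cmDatum L 3 H).toAdelic γ₀))) = 1 :=
      kottwitzSignLocal_eq_one_of_smul_ne L 3 H v w hw _
    rw [h1]
    obtain ⟨ε, hε0, hε, -⟩ := exists_conj_mul_self_eq_zero_of_smul_ne v w hw
    constructor
    · intro h; exact absurd (congrArg Units.val h) (by decide)
    · intro h
      exfalso
      apply h
      refine ⟨![ε, 0], ?_, ?_⟩
      · intro h0
        exact hε0 (by simpa using congrFun h0 0)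
      · simp only [Matrix.cons_val_zero, Matrix.cons_val_one, map_zero, mul_zero, add_zero]
        rw [← hσv, hε, mul_zero]

end Finite

/-! ## §3 The complex places -/

section Complex

/-- **Binary hermitian forms over `ℂ`**: for REAL `x, y ≠ 0`, `x|u₀|² + y|u₁|²` is anisotropic iff `x y > 0` (same sign).
[cite: Rogawski1990, §8.2 p. 117] -/
theorem binary_anisotropic_iff_mul_pos {x y : ℂ} (hx : x.im = 0) (hy : y.im = 0) (hx0 : x ≠ 0) (hy0 : y ≠ 0) :
    (∀ u : Fin 2 → ℂ, x * (conj (u 0) * u 0) + y * (conj (u 1) * u 1) = 0 → u = 0) ↔ 0 < (x * y).re := by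
  have hxre : x.re ≠ 0 := fun h => hx0 (Complex.ext h hx)
  have hyre : y.re ≠ 0 := fun h => hy0 (Complex.ext h hy)
  have hcn : ∀ z : ℂ, conj z * z = ((Complex.normSq z : ℝ) : ℂ) := fun z => by rw [Complex.normSq_eq_conj_mul_self]
  have hxyre : (x * y).re = x.re * y.re := by rw [Complex.mul_re, hx, hy, mul_zero, sub_zero]
  rw [hxyre]
  constructor
  · intro h
    by_contra hle
    push Not at hle
    have hneg : x.re * y.re < 0 := lt_of_le_of_ne hle (mul_ne_zero hxre hyre)
    -- the vector `(√|y|, √|x|)` is isotropic and non-zero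
    set u : Fin 2 → ℂ := ![((Real.sqrt |y.re| : ℝ) : ℂ), ((Real.sqrt |x.re| : ℝ) : ℂ)] with hu
    have hu0 : u ≠ 0 := by
      intro h0
      have h1 := congrFun h0 0
      simp only [hu, Matrix.cons_val_zero, Pi.zero_apply, Complex.ofReal_eq_zero] at h1
      rw [Real.sqrt_eq_zero (abs_nonneg _), abs_eq_zero] at h1
      exact hyre h1
    apply hu0 (h u _)
    have h0 : ∀ r : ℝ, conj ((r : ℂ)) * (r : ℂ) = ((r * r : ℝ) : ℂ) := fun r => by
      rw [Complex.conj_ofReal, ← Complex.ofReal_mul]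
    simp only [hu, Matrix.cons_val_zero, Matrix.cons_val_one, h0, Real.mul_self_sqrt (abs_nonneg _)]
    apply Complex.ext
    · simp only [Complex.add_re, Complex.mul_re, Complex.ofReal_re, Complex.ofReal_im, hx, hy, zero_mul, sub_zero, Complex.zero_re]
      rcases lt_or_gt_of_ne hxre with hxn | hxp
      · have hyp : 0 < y.re := by nlinarith
        rw [abs_of_pos hyp, abs_of_neg hxn]; ring
      · have hyn : y.re < 0 := by nlinarith
        rw [abs_of_neg hyn, abs_of_pos hxp]; ring
    · simp only [Complex.add_im, Complex.mul_im, Complex.ofReal_re, Complex.ofReal_im, hx, hy, zero_mul, mul_zero, add_zero,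
        Complex.zero_im]
  · intro hpos u hu
    have hre := congrArg Complex.re hu
    rw [hcn, hcn] at hre
    simp only [Complex.add_re, Complex.mul_re, Complex.ofReal_re, Complex.ofReal_im, hx, hy, zero_mul, sub_zero, Complex.zero_re] at hre
    have h0 : 0 ≤ Complex.normSq (u 0) := Complex.normSq_nonneg _
    have h1 : 0 ≤ Complex.normSq (u 1) := Complex.normSq_nonneg _
    -- same sign ⇒ both terms vanish
    have hn0 : Complex.normSq (u 0) = 0 ∧ Complex.normSq (u 1) = 0 := by
      rcases lt_or_gt_of_ne hxre with hxn | hxp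
      · have hyn : y.re < 0 := by nlinarith
        have ha : Complex.normSq (u 0) ≤ 0 := by nlinarith [mul_nonpos_iff.2 (Or.inr ⟨hyn.le, h1⟩)]
        have hb : Complex.normSq (u 1) ≤ 0 := by nlinarith [mul_nonpos_iff.2 (Or.inr ⟨hxn.le, h0⟩)]
        exact ⟨le_antisymm ha h0, le_antisymm hb h1⟩
      · have hyp : 0 < y.re := by nlinarith
        have ha : Complex.normSq (u 0) ≤ 0 := by nlinarith [mul_nonneg hyp.le h1]
        have hb : Complex.normSq (u 1) ≤ 0 := by nlinarith [mul_nonneg hxp.le h0]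
        exact ⟨le_antisymm ha h0, le_antisymm hb h1⟩
    ext i
    fin_cases i
    · exact Complex.normSq_eq_zero.1 hn0.1
    · exact Complex.normSq_eq_zero.1 hn0.2

variable {L : Type} [Field L] [NumberField L] [IsCMField L] {H : Matrix (Fin 3) (Fin 3) L}

/-- **The coordinate sign of `γ₀ ⊗ 1` at a complex place `W` in a diagonal frame is the sign of the diagonal model over `ℂ`** (frame
mapped by the embedding `σ_W`, ★ `kottwitzSign_eq_of_frame`; ★ `IsCMField.complexEmbedding_complexConj`).
[cite: Rogawski1990, §3.8 Prop. 3.8.1 p. 30; §4.1 (4.1.2) p. 39] -/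
theorem kottwitzSignAt_cmRationalToArch_eq_diagonal (W : {w : InfinitePlace L // IsComplex w}) (γ₀ : (UnitaryGroup.cmDatum L 3 H).Rational)
    {a b : L} {P : GL (Fin 3) L} {d : Fin 3 → L}
    (hP : (((P : Matrix (Fin 3) (Fin 3) L)).map (cmConjRingHom L))ᵀ * H * (P : Matrix (Fin 3) (Fin 3) L) = Matrix.diagonal d)
    (hγP : (((γ₀ : unitaryGroup (cmConjRingHom L) H).val : GL (Fin 3) L).val : Matrix (Fin 3) (Fin 3) L) * (P : Matrix (Fin 3) (Fin 3) L) =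
      (P : Matrix (Fin 3) (Fin 3) L) * finSum 2 1 (a • (1 : Matrix (Fin 2) (Fin 2) L)) (b • (1 : Matrix (Fin 1) (Fin 1) L))) :
    kottwitzSignAt L 3 H W (cmRationalToArch L 3 H γ₀) =
      kottwitzSign (starRingEnd ℂ) (Matrix.diagonal (fun i => W.1.embedding (d i)))
        (Matrix.diagonal ![W.1.embedding a, W.1.embedding a, W.1.embedding b]) := by
  set φ : L →+* ℂ := W.1.embedding with hφ
  unfold kottwitzSignAt
  rw [UnitaryGroup.archFormOf_map_evalC]
  have hmat : ((((cmRationalToArch L 3 H γ₀ : ↥(UnitaryGroup.arch (↥(maximalRealSubfield L)) L (IsCMField.complexConj L) 3 H)) :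
        GL (Fin 3) (mixedEmbedding.mixedSpace L)) : Matrix (Fin 3) (Fin 3) (mixedEmbedding.mixedSpace L)).map (UnitaryGroup.evalC L W)) =
      ((((γ₀ : unitaryGroup (cmConjRingHom L) H).val : GL (Fin 3) L).val : Matrix (Fin 3) (Fin 3) L)).map φ := by
    change (((((γ₀ : unitaryGroup (cmConjRingHom L) H).val : GL (Fin 3) L).val : Matrix (Fin 3) (Fin 3) L)).map (mixedEmbedding L)).map
        (UnitaryGroup.evalC L W) = _
    rw [Matrix.map_map]
    rfl
  rw [hmat]
  -- mapped frame over `ℂ`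
  set Pc : GL (Fin 3) ℂ := Matrix.GeneralLinearGroup.map φ P with hPc
  have hPcval : (Pc : Matrix (Fin 3) (Fin 3) ℂ) = (P : Matrix (Fin 3) (Fin 3) L).map φ := rfl
  have hσφ : ∀ x : L, starRingEnd ℂ (φ x) = φ (cmConjRingHom L x) := fun x => by
    rw [cmConjRingHom_apply, IsCMField.complexEmbedding_complexConj]
  have hframe : ((((γ₀ : unitaryGroup (cmConjRingHom L) H).val : GL (Fin 3) L).val : Matrix (Fin 3) (Fin 3) L).map φ) *
      (Pc : Matrix (Fin 3) (Fin 3) ℂ) =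
      (Pc : Matrix (Fin 3) (Fin 3) ℂ) * finSum 2 1 (φ a • (1 : Matrix (Fin 2) (Fin 2) ℂ)) (φ b • (1 : Matrix (Fin 1) (Fin 1) ℂ)) := by
    rw [hPcval, ← Matrix.map_mul, hγP, Matrix.map_mul, finSum_smul_one_eq_diagonal, finSum_smul_one_eq_diagonal,
      Matrix.diagonal_map (map_zero φ)]
    congr 2
    funext i; fin_cases i <;> rfl
  have hcongr : ((Pc : Matrix (Fin 3) (Fin 3) ℂ).map (starRingEnd ℂ))ᵀ * H.map φ * (Pc : Matrix (Fin 3) (Fin 3) ℂ) =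
      Matrix.diagonal (fun i => φ (d i)) := by
    have hmapσ : ((P : Matrix (Fin 3) (Fin 3) L).map φ).map (starRingEnd ℂ) = (((P : Matrix (Fin 3) (Fin 3) L)).map (cmConjRingHom L)).map φ := by
      rw [Matrix.map_map, Matrix.map_map]
      exact congrArg _ (funext fun x => hσφ x)
    rw [hPcval, hmapσ, ← Matrix.transpose_map, ← Matrix.map_mul, ← Matrix.map_mul, hP, Matrix.diagonal_map (map_zero φ)]
  rw [kottwitzSign_eq_of_frame (starRingEnd ℂ) (H.map φ) Pc hframe (fun i => φ (d i)) hcongr]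

/-- **THE ARCHIMEDEAN READING: `e_W(γ₀ ⊗ 1) = −1 ↔ 0 < Re σ_W(d₀ d₁)`** — the eigenplane `⟨d₀, d₁⟩` is DEFINITE at the complex place `W`
(`d₀, d₁, d₂` real non-zero, `a − b` a unit). [cite: Rogawski1990, §8.2 p. 117 («`e(γ₀′) = −1`» for the compact centraliser); §4.1 (4.1.2) p. 39] -/
theorem kottwitzSignAt_cmRationalToArch_eq_neg_one_iff (W : {w : InfinitePlace L // IsComplex w}) (γ₀ : (UnitaryGroup.cmDatum L 3 H).Rational)
    {a b : L} (hab : IsUnit (a - b)) {P : GL (Fin 3) L} {d : Fin 3 → L} (hd : ∀ i, cmConjRingHom L (d i) = d i) (hd0 : ∀ i, d i ≠ 0)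
    (hP : (((P : Matrix (Fin 3) (Fin 3) L)).map (cmConjRingHom L))ᵀ * H * (P : Matrix (Fin 3) (Fin 3) L) = Matrix.diagonal d)
    (hγP : (((γ₀ : unitaryGroup (cmConjRingHom L) H).val : GL (Fin 3) L).val : Matrix (Fin 3) (Fin 3) L) * (P : Matrix (Fin 3) (Fin 3) L) =
      (P : Matrix (Fin 3) (Fin 3) L) * finSum 2 1 (a • (1 : Matrix (Fin 2) (Fin 2) L)) (b • (1 : Matrix (Fin 1) (Fin 1) L))) :
    kottwitzSignAt L 3 H W (cmRationalToArch L 3 H γ₀) = -1 ↔ 0 < (W.1.embedding (d 0 * d 1)).re := by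
  set φ : L →+* ℂ := W.1.embedding with hφ
  have hreal : ∀ i, (φ (d i)).im = 0 := by
    intro i
    have h := IsCMField.complexEmbedding_complexConj L φ (d i)
    rw [← cmConjRingHom_apply, hd i] at h
    -- `φ dᵢ = conj (φ dᵢ)` ⇒ real
    have him := congrArg Complex.im h
    rw [Complex.conj_im] at him
    linarith
  have habφ : IsUnit (φ a - φ b) := by rw [← map_sub]; exact hab.map φ
  rw [kottwitzSignAt_cmRationalToArch_eq_diagonal W γ₀ hP hγP,
    kottwitzSign_diagonal_eq_neg_one_iff (starRingEnd ℂ) (RingHom.injective _) habφ (fun i => φ (d i))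
      ((map_ne_zero_iff φ φ.injective).2 (hd0 2)),
    map_mul]
  exact binary_anisotropic_iff_mul_pos (hreal 0) (hreal 1) ((map_ne_zero_iff φ φ.injective).2 (hd0 0))
    ((map_ne_zero_iff φ φ.injective).2 (hd0 1))

end Complex

end Literature.NumberTheory.Rogawski1990

end
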